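import Summits.Ventures.HodgeRepro.Night3WeilModel
import Summits.Ventures.HodgeRepro.Night3WeilModelFubini

/-!
# The Weil model's field `hQ` from the single-factor Rosati data: the product induction

Blind re-derivation cell `pub-hodge-repro`, seat `night-3` (gen 2).  Imports `Night3WeilModel` and `Night3WeilModelFubini`.
Namespace `HodgeRepro.Night3.WeilModel`.

The field `hQ` of a `WeilModel` («for `b ≠ 0` every line `ℓ b σ` pairs non-trivially with some line») is the weakened form
of LEMMA-L-P-v2.md step (2): «the Gram matrix of `Q′` on `W_F(B′) ⊗ ℂ` in the basis `{w′_σ}` is anti-diagonal (`σ ↔ σ̄`)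
with nonzero entries», which the note derives for the PRODUCT `B′ = ∏_i A_i` from the single factors: «`E_i(ℓ_τ, ℓ_{τ′}) = 0`
unless `τ′ = τ̄`, and nondegeneracy forces `E_i(ℓ_τ, ℓ_τ̄) ≠ 0`; `Q′(w′_σ, w′_τ) = ± ∏_i E_i(w_σ^{(i)}, w_τ^{(i)})`
(Künneth / Fubini, up to the sign of the reordering)».  typer-2's candidate `LemmaPProduct.lean` (f74894530183540a) proved
the two-factor step; the `r`-fold iteration stayed on paper.  This file does the iteration in the kernel, on the raw data
`ℓ`, `Q` of a model over a multiset monoid: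

* `IsAntidiag ℓ Q conj a` — the anti-diagonal Gram matrix of `Q a ⊗ L` on the lines of `a` along `conj` (`σ ↦ σ̄`);
* `FubiniOnLines ℓ Q` — «`Q′(w′_σ, w′_τ) = ε · Q_a(…) · Q_b(…)`, `ε ≠ 0`» on the lines of every `a + b` (the Künneth /
  Fubini identity with the reordering sign as a unit);
* `isAntidiag_add` — the two-factor step; `isAntidiag_of_single` — by induction on the multiset, every NON-EMPTY multiset
  is anti-diagonal once every singleton `{T}` is; `hQ_of_single` — the field `hQ` from that;
* `antidiag_of_rosati` — the singleton case from the Rosati data (typer-2's `bilin_eq_zero_of_ne` re-stated with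
  attribution): a Rosati-compatible form, eigenlines with pairwise distinct characters `χ` stable under the involution `ρ`
  (`χ (conj σ) = χ σ ∘ ρ`) and the weak nondegeneracy «every line pairs non-trivially with some line» give the anti-diagonal
  Gram matrix — `E(ℓ_τ, ℓ_{τ′}) = 0` unless `τ′ = τ̄`, and then `E(ℓ_τ, ℓ_τ̄) ≠ 0`;
* `fubiniOnLines_of_tensorForm` — `FubiniOnLines` itself from a MODEL-LEVEL Fubini: if the form on `B_a × B_b` is a
  non-zero rational multiple of the tensor form `Q_a ⊗ Q_b` pulled back along the Künneth map (`hQκ`), then Fubini holds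
  on the lines (`baseChange_smul_apply`, `baseChange_compl₁₂_apply`, `Night3WeilModelFubini`'s Fubini under base change,
  and the eigenline identification `hℓ`).

What stays on paper: the model-level Fubini identity (`hQκ`) (a Hodge-theoretic identification of `Q′` with the product form under
Künneth), the Rosati compatibility of each factor's polarisation form (Shimura 1998 §6.2 Thm 4, SOURCES LP2-print L1479)
and the eigenline characters.  Nothing here closes S4; no sealed file is touched; no Tier-2 item depends on this file.
-/

set_option autoImplicit false

open TensorProduct

namespace HodgeRepro.Night3.WeilModel

universe u

section Rosati

variable {L : Type*} [Field L] {V : Type*} [AddCommGroup V] [Module L V]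
variable {F : Type*} [CommRing F] [Module F V]

/-- **The Rosati computation**: if `E (a • x) y = E x (ρ a • y)` for all `a` in the ring `F` acting on `V` and `x`, `y`
are eigenvectors for the characters `τ`, `τ′ : F → L`, then `E x y = 0` unless `τ = τ′ ∘ ρ`.
(typer-2, LemmaPLinear `bilin_eq_zero_of_ne`, re-stated.) -/
theorem bilin_eq_zero_of_ne (E : LinearMap.BilinForm L V) (ρ : F →+* F)
    (hE : ∀ (a : F) (x y : V), E (a • x) y = E x (ρ a • y)) {τ τ' : F →+* L} {x y : V}
    (hx : ∀ a : F, a • x = τ a • x) (hy : ∀ a : F, a • y = τ' a • y) (hne : τ ≠ τ'.comp ρ) : E x y = 0 := by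
  obtain ⟨a, ha⟩ : ∃ a : F, τ a ≠ τ' (ρ a) := by
    by_contra h
    exact hne (RingHom.ext fun a => not_not.mp fun h' => h ⟨a, h'⟩)
  have h1 : E (a • x) y = τ a * E x y := by rw [hx a, map_smul, LinearMap.smul_apply, smul_eq_mul]
  have h2 : E x (ρ a • y) = τ' (ρ a) * E x y := by rw [hy (ρ a), map_smul, smul_eq_mul]
  have h3 : (τ a - τ' (ρ a)) * E x y = 0 := by rw [sub_mul, ← h1, ← h2, hE, sub_self]
  exact (mul_eq_zero.mp h3).resolve_left (sub_ne_zero.mpr ha)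

/-- **The anti-diagonal Gram matrix on a family of eigenlines** (the single factor of LEMMA-L-P-v2.md step (2)): `E`
Rosati-compatible for an involution `ρ`, lines `ℓ i` that are eigenvectors for pairwise distinct characters `χ i` with
`χ (conj i) = χ i ∘ ρ`, and the weak nondegeneracy «every line pairs non-trivially with some line»; then
`E (ℓ i) (ℓ j) ≠ 0 ↔ j = conj i`.  (Adapted from typer-2's `gram_antidiagonal_of_rosati`, which takes a basis of the whole
space and a left-separating form; here a family and the weak nondegeneracy.) -/
theorem antidiag_of_rosati {ι : Type*} (E : LinearMap.BilinForm L V) (ρ : F →+* F) (hρ : Function.Involutive ρ)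
    (hE : ∀ (a : F) (x y : V), E (a • x) y = E x (ρ a • y)) (ℓ : ι → V) (χ : ι → (F →+* L))
    (hℓ : ∀ i (a : F), a • ℓ i = χ i a • ℓ i) (hχ : Function.Injective χ) (conj : ι → ι)
    (hconj : ∀ i, χ (conj i) = (χ i).comp ρ) (hnd : ∀ i, ∃ j, E (ℓ i) (ℓ j) ≠ 0) (i j : ι) :
    E (ℓ i) (ℓ j) ≠ 0 ↔ j = conj i := by
  have key : ∀ i j, E (ℓ i) (ℓ j) ≠ 0 → j = conj i := by
    intro i j hij
    by_contra hne
    apply hij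
    refine bilin_eq_zero_of_ne E ρ hE (hℓ i) (hℓ j) fun h => hne ?_
    apply hχ
    rw [hconj i, h, RingHom.comp_assoc]
    have : ρ.comp ρ = RingHom.id F := RingHom.ext fun a => hρ a
    rw [this, RingHom.comp_id]
  refine ⟨key i j, fun hj => ?_⟩
  subst hj
  obtain ⟨j', hj'⟩ := hnd i
  have hj'' := key i j' hj'
  subst hj''
  exact hj'

end Rosati

section Product

variable {K L : Type*} [Field K] [Field L] [Algebra K L] {ι : Type*} {A : Type*} [AddCommMonoid A]
variable {H : A → Type u} [∀ a, AddCommGroup (H a)] [∀ a, Module K (H a)]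

/-- The Gram matrix of `Q a ⊗ L` on the lines of `a` is ANTI-DIAGONAL along `conj` (`σ ↦ σ̄`):
`Q′(w′_σ, w′_τ) ≠ 0 ↔ τ = σ̄`. -/
def IsAntidiag (ℓ : ∀ a, ι → L ⊗[K] H a) (Q : ∀ a, LinearMap.BilinForm K (H a)) (conj : ι → ι) (a : A) : Prop :=
  ∀ σ τ, (Q a).baseChange L (ℓ a σ) (ℓ a τ) ≠ 0 ↔ τ = conj σ

/-- **Fubini on the lines, up to a unit**: `Q_{a+b}(ℓ_σ, ℓ_τ) = ε · Q_a(ℓ_σ, ℓ_τ) · Q_b(ℓ_σ, ℓ_τ)` with `ε ≠ 0` (the sign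
of the reordering of the note), for all `a`, `b`, `σ`, `τ`. -/
def FubiniOnLines (ℓ : ∀ a, ι → L ⊗[K] H a) (Q : ∀ a, LinearMap.BilinForm K (H a)) : Prop :=
  ∀ a b σ τ, ∃ ε : L, ε ≠ 0 ∧ (Q (a + b)).baseChange L (ℓ (a + b) σ) (ℓ (a + b) τ) =
    ε * ((Q a).baseChange L (ℓ a σ) (ℓ a τ) * (Q b).baseChange L (ℓ b σ) (ℓ b τ))

variable {ℓ : ∀ a, ι → L ⊗[K] H a} {Q : ∀ a, LinearMap.BilinForm K (H a)} {conj : ι → ι}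

/-- **The two-factor step**: anti-diagonal on `a` and on `b` ⇒ anti-diagonal on `a + b` (Fubini). -/
theorem isAntidiag_add (hfub : FubiniOnLines ℓ Q) {a b : A} (ha : IsAntidiag ℓ Q conj a)
    (hb : IsAntidiag ℓ Q conj b) : IsAntidiag ℓ Q conj (a + b) := by
  intro σ τ
  obtain ⟨ε, hε, h⟩ := hfub a b σ τ
  rw [h, mul_ne_zero_iff, mul_ne_zero_iff, ha, hb]
  exact ⟨fun h => h.2.1, fun h => ⟨hε, h, h⟩⟩

end Product

section Multiset

variable {K L : Type*} [Field K] [Field L] [Algebra K L] {ι : Type*} {α : Type*}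
variable {H : Multiset α → Type u} [∀ a, AddCommGroup (H a)] [∀ a, Module K (H a)]
variable {ℓ : ∀ a, ι → L ⊗[K] H a} {Q : ∀ a, LinearMap.BilinForm K (H a)} {conj : ι → ι}

/-- **The product induction**: over the multisets of CM types, if every singleton `{T}` is anti-diagonal (the single
factor `A_T`: the Rosati computation) and Fubini holds on the lines, then every NON-EMPTY multiset is anti-diagonal —
«`Q′(w′_σ, w′_τ) = ± ∏_i E_i(w_σ^{(i)}, w_τ^{(i)})` is nonzero iff `τ = σ̄`» for every corner product `B′ = ∏_i A_i`. -/
theorem isAntidiag_of_single (hfub : FubiniOnLines ℓ Q) (hsingle : ∀ T : α, IsAntidiag ℓ Q conj {T}) :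
    ∀ M : Multiset α, M ≠ 0 → IsAntidiag ℓ Q conj M := by
  intro M
  induction M using Multiset.induction_on with
  | empty => intro h; exact absurd rfl h
  | cons T M ih =>
    intro _
    rw [← Multiset.singleton_add]
    by_cases h0 : M = 0
    · subst h0; rw [add_zero]; exact hsingle T
    · exact isAntidiag_add hfub (hsingle T) (ih h0)

/-- **The field `hQ` of a Weil model from the singletons**: Fubini on the lines and the anti-diagonal Gram matrix on every
single factor give «for `b ≠ 0` every line pairs non-trivially with some line» — with `τ := conj σ`. -/
theorem hQ_of_single (hfub : FubiniOnLines ℓ Q) (hsingle : ∀ T : α, IsAntidiag ℓ Q conj {T}) :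
    ∀ b : Multiset α, b ≠ 0 → ∀ σ, ∃ τ, (Q b).baseChange L (ℓ b σ) (ℓ b τ) ≠ 0 :=
  hQ_of_antidiagonal ℓ Q conj (isAntidiag_of_single hfub hsingle)

/-- **The single factor from its Rosati data**: for a CM type `T`, an action of the ring `F` (the CM field) on
`H {T} ⊗ L` for which `Q {T} ⊗ L` is Rosati-compatible (`ρ` the involution: complex conjugation on `F`), the lines
`ℓ {T} σ` eigenvectors for pairwise distinct characters `χ σ` with `χ (conj σ) = χ σ ∘ ρ`, and the weak nondegeneracy of
`Q {T} ⊗ L` on the lines; then `{T}` is anti-diagonal — the `hsingle` of `hQ_of_single`. -/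
theorem isAntidiag_single_of_rosati {F : Type*} [CommRing F] (T : α) [Module F (L ⊗[K] H {T})]
    (ρ : F →+* F) (hρ : Function.Involutive ρ)
    (hE : ∀ (a : F) (x y : L ⊗[K] H {T}),
      (Q {T}).baseChange L (a • x) y = (Q {T}).baseChange L x (ρ a • y))
    (χ : ι → (F →+* L)) (hℓ : ∀ i (a : F), a • ℓ {T} i = χ i a • ℓ {T} i) (hχ : Function.Injective χ)
    (hconj : ∀ i, χ (conj i) = (χ i).comp ρ)
    (hnd : ∀ i, ∃ j, (Q {T}).baseChange L (ℓ {T} i) (ℓ {T} j) ≠ 0) : IsAntidiag ℓ Q conj {T} :=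
  antidiag_of_rosati ((Q {T}).baseChange L) ρ hρ hE (ℓ {T}) χ hℓ hχ conj hconj hnd

end Multiset

section TensorForm

variable {K L : Type*} [Field K] [Field L] [Algebra K L]

/-- The base change of a scalar multiple of a rational form. -/
theorem baseChange_smul_apply {X : Type*} [AddCommGroup X] [Module K X] (ε : K) (B : LinearMap.BilinForm K X)
    (x y : L ⊗[K] X) :
    LinearMap.BilinForm.baseChange L (ε • B) x y = algebraMap K L ε * LinearMap.BilinForm.baseChange L B x y := by
  induction x using TensorProduct.induction_on with
  | zero => simp
  | add u v hu hv => simp only [map_add, LinearMap.add_apply, hu, hv, mul_add]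
  | tmul a m =>
    induction y using TensorProduct.induction_on with
    | zero => simp
    | add u v hu hv => simp only [map_add, hu, hv, mul_add]
    | tmul b n =>
      simp only [LinearMap.BilinForm.baseChange_tmul, LinearMap.smul_apply, smul_eq_mul, Algebra.smul_def, map_mul]
      ring

/-- Base change commutes with pulling a rational form back along a linear map. -/
theorem baseChange_compl₁₂_apply {X Y : Type*} [AddCommGroup X] [Module K X] [AddCommGroup Y] [Module K Y]
    (B : LinearMap.BilinForm K Y) (f : X →ₗ[K] Y) (x y : L ⊗[K] X) :
    LinearMap.BilinForm.baseChange L (B.compl₁₂ f f) x y =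
      LinearMap.BilinForm.baseChange L B (f.baseChange L x) (f.baseChange L y) := by
  induction x using TensorProduct.induction_on with
  | zero => simp
  | add u v hu hv => simp only [map_add, LinearMap.add_apply, hu, hv]
  | tmul a m =>
    induction y using TensorProduct.induction_on with
    | zero => simp
    | add u v hu hv => simp only [map_add, hu, hv]
    | tmul b n =>
      simp only [LinearMap.BilinForm.baseChange_tmul, LinearMap.baseChange_tmul, LinearMap.compl₁₂_apply]

variable {ι : Type*} {A : Type*} [AddCommMonoid A]

/-- **Fubini on the lines from a model-level Fubini**: if for all `a`, `b` the form on `B_a × B_b` is a non-zero rational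
multiple of the tensor form `Q_a ⊗ Q_b` pulled back along the Künneth map — `Q (a+b) = ε • (Q a ⊗ Q b) ∘ (κ × κ)`,
the note's «`Q′ = ± ∏ E_i` (Künneth / Fubini, up to the sign of the reordering)» — then `FubiniOnLines` holds. -/
theorem fubiniOnLines_of_tensorForm (X : WeilModel.{u} K L ι A)
    (hQκ : ∀ a b, ∃ ε : K, ε ≠ 0 ∧
      X.Q (a + b) = ε • ((X.Q a).tmul (X.Q b)).compl₁₂ (X.κ a b) (X.κ a b)) :
    FubiniOnLines X.ℓ X.Q := by
  intro a b σ τ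
  obtain ⟨ε, hε, h⟩ := hQκ a b
  refine ⟨algebraMap K L ε, fun h0 => hε ((algebraMap K L).injective (by rw [h0, map_zero])), ?_⟩
  rw [h, baseChange_smul_apply, baseChange_compl₁₂_apply, X.hℓ, X.hℓ, baseChange_tmul_distribBaseChange_symm]

end TensorForm

end HodgeRepro.Night3.WeilModel
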